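import Summits.ResolutionOfSingularities.ResolutionOfSingularities.Theorems.WeightedInvariantDatumToEmbeddedCentreHomogeneous
import Literature.AlgebraicGeometry.Resolution.AlterationsLemma32
import Literature.AlgebraicGeometry.Resolution.RegularLocalRingsFlatDescent
import Literature.AlgebraicGeometry.Resolution.ReducedOfSmoothOverReduced
import Literature.AlgebraicGeometry.Resolution.RegularSubschemeLocallyIrreducible
import Literature.AlgebraicGeometry.Resolution.ComponentGluing
import Literature.AlgebraicGeometry.Resolution.CanonicalResolutionProofs
import HarnessLib

/-!
# The non-regular locus of a closed subscheme is intrinsic: smooth pull-back and torus homogeneity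

Route `ResolutionOfSingularities/WeightedInvariant`, door crux `HypersurfaceCentreConstruction`
(stmt-ResolutionOfSingularities-19897), helper #3 (summit-side, OURS). Clause `(hom)` of an admissible centre
(`IsAdmissibleCentre`: on every affine chart `W` with a `ℤʲ`-grading of `Γ(Y, W)`, constants in degree `0`,
for which `X(W)` is homogeneous, every piece of the centre is homogeneous) holds AUTOMATICALLY for centres that
are built intrinsically from `V(X)`. This file proves it for the basic intrinsic construction, the reduced
non-regular locus:

* `preimage_singSet_eq_of_smooth` — for a smooth `g : T → Y` the preimage of the image in `Y` of the
  non-regular locus of `V(X)` is the image in `T` of the non-regular locus of `V(g*X) = V(X) ×_Y T`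
  (ascent EGA IV 17.5.8 `isRegularLocalRing_stalk_of_smooth`, descent Matsumura 23.7
  `IsRegularLocalRing.of_flat_of_isLocalHom`);
* `comap_vanishingIdeal_singSet_of_smooth` — hence `g*𝓘(Sing V(X)) = 𝓘(Sing V(g*X))` for the REDUCED ideals
  (a pull-back of a reduced closed subscheme along a smooth morphism is reduced, Stacks 034E
  `isReduced_of_smooth_of_isReduced_base`);
* `isClosed_singSet` — over a field the non-regular locus is closed (Matsumura 30.5 Cor.,
  `isOpen_regularLocus_of_locallyOfFiniteType_field`);
* `vanishingIdeal_singSet_isHomogeneous` — **(hom) for the reduced non-regular locus**: on a graded affine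
  chart `W` of `f : Y → Spec k` (locally of finite type; ANY `ℤʲ`-grading, no condition on the constants) with
  `X(W)` homogeneous, `𝓘(Sing V(X))(W)` and all its powers (`…_pow_isHomogeneous`) are homogeneous. Proof = the torus argument of `DatumToEmbedded.CentreHomogeneous.stub_centre_isHomogeneous`
  (coaction `act` and projection `pr : Spec Γ(Y,W)[ℤʲ] → Y` are smooth and pull `X` back to the same ideal
  sheaf; they then pull `𝓘(Sing V(X))` back to the same ideal sheaf by the two items above; compare on the
  torus chart, `isHomogeneous_of_map_coaction_le`).

No statement of H. Hironaka's manuscript is used. AI-written; weaker than expert review.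
References: Matsumura, *Commutative Ring Theory*, Thms. 23.7, 30.5 [Matsumura1987]; EGA IV₄ 17.5.8
[Grothendieck1967]; Stacks 034E [StacksProject]; Włodarczyk arXiv:2203.03090 Thm. 1.1.4 (6) [Wlodarczyk2022].
-/

noncomputable section

open CategoryTheory CategoryTheory.Limits AlgebraicGeometry TopologicalSpace IsLocalRing
open Literature.AlgebraicGeometry.Resolution

set_option linter.dupNamespace false -- mandated namespace of this single-conjunct summit

namespace Summit.ResolutionOfSingularities.ResolutionOfSingularities.Theorems

universe u

/-! ## §1 The image of the non-regular locus under smooth pull-back -/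

section Smooth

variable {T Y : Scheme.{u}} (g : T ⟶ Y) (X : Y.IdealSheafData)

/-- The comparison morphism `V(g*X) ≅ T ×_Y V(X) → V(X)` lies over `g`. [folklore] -/
theorem comapIso_hom_snd_comp_subschemeι :
    ((X.comapIso g).hom ≫ pullback.snd g X.subschemeι) ≫ X.subschemeι = (X.comap g).subschemeι ≫ g := by
  rw [Category.assoc, ← pullback.condition, ← Category.assoc, Scheme.IdealSheafData.comapIso_hom_fst]

/-- **Smooth pull-back preserves and reflects the non-regular locus**: for a smooth `g : T → Y` and an ideal
sheaf `X` on `Y`, a point `t ∈ T` lies under a non-regular point of `V(g*X)` iff `g t` lies under a non-regular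
point of `V(X)` (regularity ascends along the smooth `V(g*X) → V(X)`, EGA IV₄ 17.5.8 (iii), and descends along
its flat local stalk maps, Matsumura 23.7). [cite: Matsumura1987, Thm. 23.7 (i)] -/
theorem preimage_singSet_eq_of_smooth [Smooth g] [IsLocallyNoetherian Y] :
    g ⁻¹' {y : Y | ∃ x : X.subscheme, X.subschemeι x = y ∧
        ¬ IsRegularLocalRing (X.subscheme.presheaf.stalk x)} =
      {t : T | ∃ x : (X.comap g).subscheme, (X.comap g).subschemeι x = t ∧
        ¬ IsRegularLocalRing ((X.comap g).subscheme.presheaf.stalk x)} := by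
  haveI : IsLocallyNoetherian X.subscheme := LocallyOfFiniteType.isLocallyNoetherian X.subschemeι
  let q : (X.comap g).subscheme ⟶ X.subscheme := (X.comapIso g).hom ≫ pullback.snd g X.subschemeι
  haveI : Smooth q := inferInstance
  have hq : ∀ x, X.subschemeι (q x) = g ((X.comap g).subschemeι x) := fun x => by
    change (q ≫ X.subschemeι) x = ((X.comap g).subschemeι ≫ g) x
    rw [comapIso_hom_snd_comp_subschemeι]
  ext t
  simp only [Set.mem_preimage, Set.mem_setOf_eq]
  constructor
  · rintro ⟨x, hx, hnot⟩
    -- a point of `V(g*X)` over `(t, x)`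
    obtain ⟨z, hz1, hz2⟩ := Scheme.Pullback.exists_preimage_pullback (f := g) (g := X.subschemeι) t x hx.symm
    refine ⟨(X.comapIso g).inv z, ?_, fun hreg => hnot ?_⟩
    · change ((X.comapIso g).inv ≫ (X.comap g).subschemeι) z = t
      rw [Scheme.IdealSheafData.comapIso_inv_subschemeι]
      exact hz1
    · -- descent along the flat local stalk map of `q` at `x' = e⁻¹ z`, `q x' = x`
      have hqx : q ((X.comapIso g).inv z) = x := by
        change ((X.comapIso g).inv ≫ (X.comapIso g).hom ≫ pullback.snd g X.subschemeι) z = x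
        rw [Iso.inv_hom_id_assoc]
        exact hz2
      rw [← hqx]
      set x' := (X.comapIso g).inv z
      letI : Algebra (X.subscheme.presheaf.stalk (q x')) ((X.comap g).subscheme.presheaf.stalk x') :=
        (q.stalkMap x').hom.toAlgebra
      haveI : Module.Flat (X.subscheme.presheaf.stalk (q x')) ((X.comap g).subscheme.presheaf.stalk x') :=
        RingHom.flat_algebraMap_iff.mp (Flat.stalkMap q x')
      haveI : IsLocalHom (algebraMap (X.subscheme.presheaf.stalk (q x'))
          ((X.comap g).subscheme.presheaf.stalk x')) :=
        inferInstanceAs (IsLocalHom (q.stalkMap x').hom)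
      haveI := hreg
      exact IsRegularLocalRing.of_flat_of_isLocalHom (X.subscheme.presheaf.stalk (q x'))
        ((X.comap g).subscheme.presheaf.stalk x')
  · rintro ⟨x', hx', hnot⟩
    refine ⟨q x', by rw [hq, hx'], fun hreg => hnot ?_⟩
    exact isRegularLocalRing_stalk_of_smooth q x' hreg

/-- **Smooth pull-back of the reduced ideal of the non-regular locus**: for a smooth `g : T → Y` of locally
Noetherian `Y` and closed sets `S ⊆ Y`, `S' ⊆ T` equal to the images of the non-regular loci of `V(X)` and
of `V(g*X)`, one has `g*𝓘(S) = 𝓘(S')` — the pull-back of the reduced subscheme `S` is reduced (Stacks 034E) with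
support `g⁻¹ S = S'`. [cite: StacksProject, Tag 034E] -/
theorem comap_vanishingIdeal_singSet_of_smooth [Smooth g] [IsLocallyNoetherian Y]
    (S : Closeds Y) (hS : (S : Set Y) = {y : Y | ∃ x : X.subscheme, X.subschemeι x = y ∧
      ¬ IsRegularLocalRing (X.subscheme.presheaf.stalk x)})
    (S' : Closeds T) (hS' : (S' : Set T) = {t : T | ∃ x : (X.comap g).subscheme,
      (X.comap g).subschemeι x = t ∧ ¬ IsRegularLocalRing ((X.comap g).subscheme.presheaf.stalk x)}) :
    (Scheme.IdealSheafData.vanishingIdeal S).comap g = Scheme.IdealSheafData.vanishingIdeal S' := by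
  set J := Scheme.IdealSheafData.vanishingIdeal S with hJ
  -- the pull-back of the reduced `V(𝓘(S))` is reduced
  haveI : IsReduced J.subscheme := isReduced_subscheme_vanishingIdeal S
  haveI : IsLocallyNoetherian J.subscheme := LocallyOfFiniteType.isLocallyNoetherian J.subschemeι
  haveI : IsReduced (pullback g J.subschemeι) :=
    isReduced_of_smooth_of_isReduced_base (pullback.snd g J.subschemeι)
  haveI : IsReduced (J.comap g).subscheme := isReduced_of_isOpenImmersion (J.comapIso g).hom
  rw [← eq_vanishingIdeal_support_of_isReduced_subscheme (J.comap g)]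
  congr 1
  apply Closeds.ext
  rw [Scheme.IdealSheafData.support_comap, Closeds.coe_preimage, hJ,
    Scheme.IdealSheafData.coe_support_vanishingIdeal, hS, hS', preimage_singSet_eq_of_smooth g X]

end Smooth

/-! ## §2 Over a field the non-regular locus is closed -/

/-- **The image of the non-regular locus of `V(X)` is closed** when `Y` is locally of finite type over a field
(the regular locus of `V(X)` is open, Matsumura 30.5 Cor.; the closed immersion `V(X) → Y` is a closed map).
[cite: Matsumura1987, §30, Cor. to Thm. 30.5] -/
theorem isClosed_singSet {k : Type u} [Field k] {Y : Scheme.{u}} (f : Y ⟶ Spec (.of k))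
    [LocallyOfFiniteType f] (X : Y.IdealSheafData) :
    IsClosed {y : Y | ∃ x : X.subscheme, X.subschemeι x = y ∧
      ¬ IsRegularLocalRing (X.subscheme.presheaf.stalk x)} := by
  have hopen : IsOpen (Scheme.regularLocus X.subscheme) :=
    isOpen_regularLocus_of_locallyOfFiniteType_field (X.subschemeι ≫ f)
  have heq : {y : Y | ∃ x : X.subscheme, X.subschemeι x = y ∧
      ¬ IsRegularLocalRing (X.subscheme.presheaf.stalk x)} =
        X.subschemeι '' (Scheme.regularLocus X.subscheme)ᶜ := by
    ext y
    simp only [Set.mem_setOf_eq, Set.mem_image, Set.mem_compl_iff, Scheme.regularLocus]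
    constructor
    · rintro ⟨x, hx, h⟩; exact ⟨x, h, hx⟩
    · rintro ⟨x, h, hx⟩; exact ⟨x, hx, h⟩
  rw [heq]
  exact X.subschemeι.isClosedEmbedding.isClosedMap _ hopen.isClosed_compl

/-! ## §3 `(hom)` for the reduced non-regular locus on graded charts -/

section Hom

open DatumToEmbedded.CentreHomogeneous AddMonoidAlgebra

/-- **The reduced ideal of the non-regular locus is homogeneous on every torus chart of the pair.** Let
`f : Y → Spec k` be locally of finite type, `X` an ideal sheaf on `Y`, `S ⊆ Y` the (closed) image of the
non-regular locus of `V(X)`, `W ⊆ Y` an affine open and `𝒜` ANY `ℤʲ`-grading of `Γ(Y, W)` for which `X(W)` is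
homogeneous (the constants need not sit in degree `0`). Then `𝓘(S)(W)` is homogeneous. The coaction `act` and
the projection `pr : Spec Γ(Y, W)[ℤʲ] → Y` of the grading are smooth morphisms pulling `X` back to the same ideal sheaf
(`map_coaction_eq_of_isHomogeneous`); by `comap_vanishingIdeal_singSet_of_smooth` both pull `𝓘(S)` back to the
reduced ideal of the non-regular locus of that common pull-back; reading this on the torus chart gives
`ρ(𝓘(S)(W)) = 𝓘(S)(W)·Γ(Y,W)[ℤʲ]`, i.e. homogeneity (`isHomogeneous_of_map_coaction_le`) — Włodarczyk's
"functoriality for group actions" for the intrinsic centre `S`. [cite: Wlodarczyk2022, Thm. 1.1.4 (6)] -/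
theorem vanishingIdeal_singSet_isHomogeneous {k : Type} [Field k] {Y : Scheme.{0}}
    (f : Y ⟶ Spec (.of k)) [LocallyOfFiniteType f] (X : Y.IdealSheafData) (S : Closeds Y)
    (hS : (S : Set Y) = {y : Y | ∃ x : X.subscheme, X.subschemeι x = y ∧
      ¬ IsRegularLocalRing (X.subscheme.presheaf.stalk x)})
    {j : ℕ} (W : Y.affineOpens) (𝒜 : (Fin j → ℤ) → AddSubgroup Γ(Y, W)) [GradedRing 𝒜]
    (hX : (X.ideal W).IsHomogeneous 𝒜) :
    ((Scheme.IdealSheafData.vanishingIdeal S).ideal W).IsHomogeneous 𝒜 := by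
  haveI : IsLocallyNoetherian Y := LocallyOfFiniteType.isLocallyNoetherian f
  haveI : IsNoetherianRing Γ(Y, W) := IsLocallyNoetherian.component_noetherian W
  obtain ⟨ρ, hρ⟩ := exists_coaction 𝒜
  -- the torus chart `T = 𝔾ₘʲ × W` with its action and projection maps to `Y`
  let L : Type := (Γ(Y, W) : Type)[Fin j → ℤ]
  let T : Scheme.{0} := Spec (.of L)
  let φa : Γ(Y, W) ⟶ CommRingCat.of L := CommRingCat.ofHom ρ
  let φp : Γ(Y, W) ⟶ CommRingCat.of L := CommRingCat.ofHom singleZeroRingHom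
  let act : T ⟶ Y := Spec.map φa ≫ W.2.fromSpec
  let pr : T ⟶ Y := Spec.map φp ≫ W.2.fromSpec
  haveI : Smooth (Spec.map φa) :=
    (HasRingHomProperty.Spec_iff (P := @Smooth)).mpr (smooth_coaction 𝒜 ρ hρ)
  haveI : Smooth (Spec.map φp) :=
    (HasRingHomProperty.Spec_iff (P := @Smooth)).mpr (smooth_singleZeroRingHom _ j)
  haveI : Smooth act := inferInstance
  haveI : Smooth pr := inferInstance
  haveI : LocallyOfFiniteType (act ≫ f) := inferInstance
  -- `act` and `pr` pull `X` back to the same ideal sheaf (`X(W)` is homogeneous)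
  have hcomapT : X.comap act = X.comap pr := by
    refine Scheme.IdealSheafData.ext_of_isAffine ?_
    simp only [act, pr]
    rw [comap_SpecMap_fromSpec_ideal_top, comap_SpecMap_fromSpec_ideal_top]
    simp only [φa, φp, CommRingCat.hom_ofHom]
    rw [map_coaction_eq_of_isHomogeneous 𝒜 ρ hρ hX]
  -- hence they pull `𝓘(S)` back to the same ideal sheaf: the reduced non-regular locus of the common pull-back
  let S' : Closeds T := ⟨{t : T | ∃ x : (X.comap act).subscheme, (X.comap act).subschemeι x = t ∧
      ¬ IsRegularLocalRing ((X.comap act).subscheme.presheaf.stalk x)}, isClosed_singSet (act ≫ f) _⟩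
  have ha := comap_vanishingIdeal_singSet_of_smooth act X S hS S' rfl
  have hS'pr : (S' : Set T) = {t : T | ∃ x : (X.comap pr).subscheme, (X.comap pr).subschemeι x = t ∧
      ¬ IsRegularLocalRing ((X.comap pr).subscheme.presheaf.stalk x)} := by
    rw [← hcomapT]
    rfl
  have hp := comap_vanishingIdeal_singSet_of_smooth pr X S hS S' hS'pr
  have hC : (Scheme.IdealSheafData.vanishingIdeal S).comap act =
      (Scheme.IdealSheafData.vanishingIdeal S).comap pr := ha.trans hp.symm
  -- read on the torus chart
  have hC' := congrArg (fun K : T.IdealSheafData => K.ideal ⟨⊤, isAffineOpen_top T⟩) hC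
  simp only [act, pr] at hC'
  rw [comap_SpecMap_fromSpec_ideal_top, comap_SpecMap_fromSpec_ideal_top] at hC'
  simp only [φa, φp, CommRingCat.hom_ofHom] at hC'
  exact isHomogeneous_of_map_coaction_le 𝒜 ρ hρ (ideal_map_iso_inv_injective _ hC').le

/-- Powers of the reduced ideal of the non-regular locus are homogeneous on every torus chart of the pair
(the clause `(hom)` of `IsAdmissibleCentre` for the Rees algebra `⊕ 𝓘(S)ⁿ tⁿ`). [cite: Wlodarczyk2022, Thm. 1.1.4 (6)] -/
theorem vanishingIdeal_singSet_pow_isHomogeneous {k : Type} [Field k] {Y : Scheme.{0}}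
    (f : Y ⟶ Spec (.of k)) [LocallyOfFiniteType f] (X : Y.IdealSheafData) (S : Closeds Y)
    (hS : (S : Set Y) = {y : Y | ∃ x : X.subscheme, X.subschemeι x = y ∧
      ¬ IsRegularLocalRing (X.subscheme.presheaf.stalk x)})
    {j : ℕ} (W : Y.affineOpens) (𝒜 : (Fin j → ℤ) → AddSubgroup Γ(Y, W)) [GradedRing 𝒜]
    (hX : (X.ideal W).IsHomogeneous 𝒜)
    (n : ℕ) : (((Scheme.IdealSheafData.vanishingIdeal S) ^ n).ideal W).IsHomogeneous 𝒜 := by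
  rw [Scheme.IdealSheafData.ideal_pow, Pi.pow_apply]
  have h := vanishingIdeal_singSet_isHomogeneous f X S hS W 𝒜 hX
  induction n with
  | zero => rw [pow_zero, Ideal.one_eq_top]; exact Ideal.IsHomogeneous.top 𝒜
  | succ n ih => rw [pow_succ]; exact Ideal.IsHomogeneous.mul ih h

end Hom

end Summit.ResolutionOfSingularities.ResolutionOfSingularities.Theorems

end
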